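import Summits.QuantumAdvantage.AdviceFreeQNC0.AffBells27Windows
import HarnessLib

/-!
# `DensityUpgradeWin` reduced to a pure count (planner qn-p1 g27, ROUND-26 §4; ask P-27c — the arithmetic half)

Prover seat qn-prover-3 g14.  **`densityUpgradeWin_of_count`**: the windowed density upgrade `AffBells26.DensityUpgradeWin` follows from the
purely combinatorial WINDOW COUNT
`Σ_{x odd} refFrac β c Z x ≤ 2^{Z+3} · #{ℓ odd : (β, c) loses on ℓ}`
(for all `N ≥ 5`, `Z`, `β`, `c`).  The reduction is the bookkeeping `#{odd} = 2^{N−1}` (`Fib19.card_isOdd`),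
`#{odd winners} = affWinCard β c`, so `#{odd losers} = 2^{N−1} − affWinCard β c`; the hypotheses `CubeIdentityGen`, `TargetFormula` of
`DensityUpgradeWin` are tree theorems and are only needed INSIDE the count (through `exists_lost_of_mismatch`, `AffBells27MismatchLoss.lean`).
What remains for P-27c is exactly the telescoping double count of ROUND-26 §4 (each lost `ℓ` receives weight `≤ 8·2^Z`).
WHAT THIS IS NOT: the count itself is NOT proved here; separation NOT moved.
-/

namespace Summit.QuantumAdvantage.AdviceFreeQNC0

namespace AffBells26

open Finset Literature.Computability.QuantumComplexity Literature.Computability.QuantumComplexity.RingHLF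
open AffBells23 Fib19

/-- Odd losers = odd class − odd winners. -/
theorem card_odd_losers {N : ℕ} (hN : 1 ≤ N) (β : Fin N → Fin N → ZMod 3) (c : Fin N → ZMod 3) :
    ((((univ : Finset (Fin N → Bool)).filter fun x => IsOdd x).filter
        fun ℓ => ¬ RingHLF.Rel ℓ (affBell β c ℓ)).card : ℝ) = (2 : ℝ) ^ (N - 1) - (affWinCard β c : ℝ) := by
  classical
  have hwon : affWinCard β c =
      (((univ : Finset (Fin N → Bool)).filter fun x => IsOdd x).filter fun ℓ => RingHLF.Rel ℓ (affBell β c ℓ)).card := by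
    unfold affWinCard
    congr 1
    ext x
    simp only [mem_filter, mem_univ, true_and, isOdd_iff_oddZeros]
  have hsplit := card_filter_add_card_filter_not
    (s := (univ : Finset (Fin N → Bool)).filter fun x => IsOdd x) (fun ℓ => RingHLF.Rel ℓ (affBell β c ℓ))
  rw [card_isOdd hN, ← hwon] at hsplit
  have h2 : ((2 ^ (N - 1) : ℕ) : ℝ) = (2 : ℝ) ^ (N - 1) := by push_cast; ring
  rw [← h2, ← hsplit]
  push_cast
  ring

/-- **`DensityUpgradeWin` from the window count.** -/
theorem densityUpgradeWin_of_count
    (h : ∀ N : ℕ, 5 ≤ N → ∀ (Z : ℕ) (β : Fin N → Fin N → ZMod 3) (c : Fin N → ZMod 3),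
      (∑ x ∈ (univ : Finset (Fin N → Bool)).filter (fun x => IsOdd x), refFrac β c Z x) ≤
        (2 : ℝ) ^ (Z + 3) * ((((univ : Finset (Fin N → Bool)).filter fun x => IsOdd x).filter
          fun ℓ => ¬ RingHLF.Rel ℓ (affBell β c ℓ)).card : ℝ)) :
    DensityUpgradeWin := by
  intro _ _ N hN Z δ β c _ hW
  have hcount := h N hN Z β c
  rw [card_odd_losers (by omega) β c] at hcount
  unfold WindowRefutable at hW
  have hpos : (0 : ℝ) < (2 : ℝ) ^ (Z + 3) := by positivity
  rw [div_le_iff₀ hpos]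
  have := hW.trans hcount
  linarith

end AffBells26

end Summit.QuantumAdvantage.AdviceFreeQNC0
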